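import Literature.NumberTheory.LocalFields.CompleteValuedSquareRootNearOne   -- ★ `isSquare_of_valued_sub_one_lt_four_adicCompletion` (squares near 1 in `K_v`)
import Mathlib.NumberTheory.Padics.Complex
import Mathlib.NumberTheory.NumberField.Completion.FinitePlace
import Mathlib.Topology.Algebra.Module.FiniteDimension
import Mathlib.Topology.Algebra.Algebra
import Mathlib.Topology.Algebra.Field
import Mathlib.FieldTheory.IntermediateField.Adjoin.Basic
import HarnessLib

/-!
# R90-TF · S3, (U3-F) brick P2″: TRANSPORT OF KRASNER DATA FROM `Q̄_p` BACK TO A `p`-ADIC COMPLETION `K`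
# (`Theorems/R90S3KrasnerTransportToCompletion.lean`; dealer R90-C12-plan (g2) memo `DEAL-S3-U3F-SPLIT.v2.md` §1 row P2″, dealt to K2E4-p14 (g12) 2026-09-05T00:39:24Z)

Cell `hodgecm-mathlib`, crux H413 (`stmt-HodgeConjecture-24833`), route of record `HCCMUnconditional`; programme R90-TF, section S3 (base `R90-C12`), the (U3-F)
auxiliary-globalisation residual `stub_R90_S3_auxGlobaliseField` (ℚ-planted road, memo v2 §2: «everything p-adic happens in `Q̄_p := PadicAlgCl p` over `ℚ_[p]`; `K` enters
only through `ι` and through P1»).  Lane `--supports stmt-HodgeConjecture-24833 --as helper`; THEOREMS ONLY; ★∕Mathlib-only imports; ns `…R90.S3`.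

THE MATHEMATICS [Neukirch, *ANT*, II (8.2)–(8.4); Serre, *Local Fields*, II §5; Gouvêa, *p-adic Numbers*, Cor. 6.8.3].  `K` a field, finite over `ℚ_p` through a structure map
that is continuous for a Hausdorff ring topology on `K` (the use: `K = L⁺_v` with the tree's `adicCompletionPadicAlgebra`, any such structure being THE canonical one),
`ι : K →ₐ[ℚ_p] Q̄_p` a `ℚ_p`-embedding into Mathlib's `PadicAlgCl p`.
* §1 (1) `isInducing_algHom_padicAlgCl`: `ι` is a homeomorphism onto its image — a `ℚ_p`-linear injection of the finite-dimensional Hausdorff `ℚ_p`-space `K` (Mathlib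
  `LinearEquiv.toContinuousLinearEquiv` on the corestriction, composed with the subtype embedding); `isClosed_range_algHom_padicAlgCl`.
* §2 (2) `exists_eq_and_adjoin_eq_top`: TRANSPORT — if `ℚ_p⟮y⟯ = ⊤` in `K` and `z ∈ Q̄_p` generates the same subfield as `ι y`, `ℚ_p⟮z⟯ = ℚ_p⟮ι y⟯` (the conclusion of ★
  `KrasnerLocallyConstant.adjoin_eq_adjoin_of_coeff_near`), then `z = ι β` for a (unique) `β ∈ K` with `ℚ_p⟮β⟯ = ⊤` (pure algebra: `ℚ_p⟮ι y⟯ = ι(ℚ_p⟮y⟯) = ι(K)`).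
* §3 (3) `denseRange_of_adjoin_eq_top`: DENSITY — if `ℚ_p⟮β⟯ = ⊤` then EVERY ring homomorphism `J : F′ →+* K` from a field whose image contains `β` has dense image (the
  closure of `J(F′)` is a closed subfield containing `ℚ` hence `ℚ_p` — `ℚ` is dense in `ℚ_p`, the structure map is continuous — and `β`).
* §4 (4) at `K := L_w` (a finite place `w` of a number field, Mathlib's normed∕valued completion): `exists_radius_sq_class` — for `y ≠ 0` there is `r > 0` such that every
  `β` with `‖ι β − ι y‖ < r` lies in the square class of `y`, `β = y·s²` ((1) + ★ `isSquare_of_valued_sub_one_lt_four_adicCompletion`); HEAD `exists_radius_transport_sq_class`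
  = (2) + (4) at one radius: the P8 step «roots `z` near `ι y` with `ℚ_p⟮z⟯ = ℚ_p⟮ι y⟯` come from `β ∈ K`, `ℚ_p⟮β⟯ = ⊤`, `β ∈ y·K^{×2}`», after which (3) makes the planted
  embedding `F′ = ℚ(α) → K`, `α ↦ β`, dense — the input of P1 ★ `exists_adicCompletion_ringEquiv_of_denseRange`.
HONEST LABEL: P2″ is a sub-brick of the GENUINE residual (U3-F) and closes nothing alone; HC_CM is proved only modulo the 7 printed citations (2 remaining named
inputs: hLiu418 = stmt-HodgeConjecture-24832, h413 = stmt-HodgeConjecture-24833) until rung 0 closes; count-neutral helper.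

## References
* [NeukirchANT1999] J. Neukirch, *Algebraic Number Theory*, Grundlehren 322 (1999), Ch. II (8.2)–(8.4).
* [Serre1979] J.-P. Serre, *Local Fields*, GTM 67 (1979), Ch. II §5.
* [Gouvea1993PadicNumbers] F. Q. Gouvêa, *p-adic Numbers*, Universitext (1993), Thm. 6.8.2 (Krasner), Cor. 6.8.3.
-/

set_option autoImplicit false
-- the mandated namespace repeats the single-problem summit's segment (`HodgeConjecture.HodgeConjecture`)
set_option linter.dupNamespace false

noncomputable section

open IntermediateField Topology IsDedekindDomain NumberField

namespace Summit.HodgeConjecture.HodgeConjecture.R90.S3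

variable (p : ℕ) [Fact p.Prime]

section Generic

variable {K : Type*} [Field K] [Algebra ℚ_[p] K]

/-! ## §1 `ι : K →ₐ[ℚ_p] Q̄_p` is a homeomorphism onto its (closed) image -/

/-- **A `ℚ_p`-embedding of a finite extension `K` of `ℚ_p` (Hausdorff ring topology, continuous structure map) into `Q̄_p` INDUCES the topology of `K`** — the
corestriction onto the finite-dimensional image is a linear homeomorphism (Mathlib `LinearEquiv.toContinuousLinearEquiv`). [cite: Serre1979, Ch. II §5]
[cite: NeukirchANT1999, Ch. II (8.2)] -/
theorem isInducing_algHom_padicAlgCl [TopologicalSpace K] [IsTopologicalRing K] [T2Space K] [FiniteDimensional ℚ_[p] K]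
    (hc : Continuous (algebraMap ℚ_[p] K)) (ι : K →ₐ[ℚ_[p]] PadicAlgCl p) : IsInducing ι := by
  haveI : ContinuousSMul ℚ_[p] K := continuousSMul_of_algebraMap ℚ_[p] K hc
  let W : Submodule ℚ_[p] (PadicAlgCl p) := LinearMap.range ι.toLinearMap
  let eW : K ≃ₗ[ℚ_[p]] W := LinearEquiv.ofInjective ι.toLinearMap ι.toRingHom.injective
  let eW' : K ≃L[ℚ_[p]] W := eW.toContinuousLinearEquiv
  have h : (ι : K → PadicAlgCl p) = Subtype.val ∘ eW' := funext fun x => rfl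
  rw [h]
  exact IsInducing.subtypeVal.comp eW'.toHomeomorph.isInducing

/-- … and its image is CLOSED (a finite-dimensional `ℚ_p`-subspace of `Q̄_p`, Mathlib `Submodule.closed_of_finiteDimensional`). [cite: Serre1979, Ch. II §5] -/
theorem isClosed_range_algHom_padicAlgCl [FiniteDimensional ℚ_[p] K] (ι : K →ₐ[ℚ_[p]] PadicAlgCl p) : IsClosed (Set.range ι) := by
  have h : Set.range ι = (LinearMap.range ι.toLinearMap : Set (PadicAlgCl p)) := by
    ext z
    simp only [Set.mem_range, SetLike.mem_coe, LinearMap.mem_range, AlgHom.toLinearMap_apply]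
  rw [h]
  exact (LinearMap.range ι.toLinearMap).closed_of_finiteDimensional

/-! ## §2 TRANSPORT of a generator from `Q̄_p` to `K` -/

/-- `ℚ_p⟮ι y⟯ = ι(ℚ_p⟮y⟯)` (Mathlib `IntermediateField.adjoin_map`). [cite: NeukirchANT1999, Ch. II (8.2)] -/
theorem adjoin_algHom_apply_eq_map (ι : K →ₐ[ℚ_[p]] PadicAlgCl p) (y : K) : ℚ_[p]⟮ι y⟯ = (ℚ_[p]⟮y⟯).map ι := by
  rw [adjoin_map, Set.image_singleton]

/-- **TRANSPORT.**  If `y` generates `K` over `ℚ_p` (`ℚ_p⟮y⟯ = ⊤`) and `z ∈ Q̄_p` generates the same subfield as `ι y` (`ℚ_p⟮z⟯ = ℚ_p⟮ι y⟯` — the conclusion of Krasner's local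
constancy ★ `adjoin_eq_adjoin_of_coeff_near`), then `z = ι β` for some `β ∈ K`, and every such `β` generates `K`: `ℚ_p⟮β⟯ = ⊤`. [cite: Gouvea1993PadicNumbers, Cor. 6.8.3]
[cite: NeukirchANT1999, Ch. II (8.2)] -/
theorem exists_eq_and_adjoin_eq_top (ι : K →ₐ[ℚ_[p]] PadicAlgCl p) {y : K} (hy : ℚ_[p]⟮y⟯ = ⊤) {z : PadicAlgCl p} (hz : ℚ_[p]⟮z⟯ = ℚ_[p]⟮ι y⟯) :
    ∃ β : K, ι β = z ∧ ℚ_[p]⟮β⟯ = ⊤ := by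
  -- `z ∈ ℚ_p⟮ι y⟯ = ι(⊤)`
  have hzmem : z ∈ (ℚ_[p]⟮y⟯).map ι := by
    rw [← adjoin_algHom_apply_eq_map, ← hz]
    exact mem_adjoin_simple_self ℚ_[p] z
  obtain ⟨β, -, hβ⟩ := (IntermediateField.mem_map _).1 hzmem
  refine ⟨β, hβ, ?_⟩
  -- `ι(ℚ_p⟮β⟯) = ℚ_p⟮z⟩ = ι(⊤)`, and `ι` is injective
  have hmap : (ℚ_[p]⟮β⟯).map ι = (⊤ : IntermediateField ℚ_[p] K).map ι := by
    rw [← adjoin_algHom_apply_eq_map, hβ, hz, adjoin_algHom_apply_eq_map, hy]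
  refine eq_top_iff.2 fun x _ => ?_
  have hx : ι x ∈ (ℚ_[p]⟮β⟯).map ι := by
    rw [hmap]
    exact (IntermediateField.mem_map _).2 ⟨x, mem_top, rfl⟩
  obtain ⟨x', hx', hxx'⟩ := (IntermediateField.mem_map _).1 hx
  rwa [← ι.toRingHom.injective hxx']

/-! ## §3 DENSITY of any subfield image containing a generator -/

/-- **DENSITY.**  `K` a topological field with continuous structure map `ℚ_p → K`; if `β` generates `K` over `ℚ_p` (`ℚ_p⟮β⟯ = ⊤`), then every ring homomorphism
`J : F′ →+* K` out of a field with `β ∈ J(F′)` has DENSE image: the closure of `J(F′)` is a closed subfield (Mathlib `Subfield.topologicalClosure`) containing `ℚ`, hence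
`ℚ_p` (`ℚ` is dense in `ℚ_p`, Mathlib `Padic.denseRange_ratCast`), and `β`, hence `ℚ_p⟮β⟯ = K`. [cite: NeukirchANT1999, Ch. II (8.2)] -/
theorem denseRange_of_adjoin_eq_top [TopologicalSpace K] [IsTopologicalDivisionRing K] (hc : Continuous (algebraMap ℚ_[p] K))
    {β : K} (hβ : ℚ_[p]⟮β⟯ = ⊤) {F' : Type*} [Field F'] (J : F' →+* K) (hJβ : β ∈ Set.range J) : DenseRange J := by
  set S : Subfield K := J.fieldRange.topologicalClosure with hS
  have hScoe : (S : Set K) = closure (Set.range J) := rfl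
  -- `ℚ_p ⊆ S`
  have hQp : Set.range (algebraMap ℚ_[p] K) ⊆ S := by
    refine (hc.range_subset_closure_image_dense (Padic.denseRange_ratCast p)).trans ?_
    rw [hScoe]
    refine closure_mono ?_
    rintro _ ⟨_, ⟨q, rfl⟩, rfl⟩
    exact ⟨q, by rw [map_ratCast, map_ratCast]⟩
  -- `β ∈ S`
  have hβS : β ∈ S := by
    obtain ⟨x, rfl⟩ := hJβ
    exact J.fieldRange.le_topologicalClosure ⟨x, rfl⟩
  -- hence `⊤ = ℚ_p⟮β⟯ ≤ S`
  have htop : (⊤ : IntermediateField ℚ_[p] K).toSubfield ≤ S := by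
    rw [← hβ, adjoin_toSubfield]
    exact Subfield.closure_le.2 (Set.union_subset hQp (Set.singleton_subset_iff.2 hβS))
  -- conclude
  change Dense (Set.range J)
  rw [dense_iff_closure_eq, ← hScoe, Set.eq_univ_iff_forall]
  exact fun x => htop (show x ∈ (⊤ : IntermediateField ℚ_[p] K).toSubfield from trivial)

end Generic

/-! ## §4 At the completion `K := L_w` of a number field: square classes are open, read through `ι`; HEAD -/

section AdicCompletion

variable {L : Type*} [Field L] [NumberField L] (w : HeightOneSpectrum (𝓞 L))
  [Algebra ℚ_[p] (w.adicCompletion L)] [FiniteDimensional ℚ_[p] (w.adicCompletion L)]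

/-- **Square classes are open, read in `Q̄_p`.**  At `K := L_w` with a continuous `ℚ_p`-structure and `ι : K →ₐ[ℚ_p] Q̄_p`: for `y ≠ 0` there is `r > 0` such that every `β ∈ K`
with `‖ι β − ι y‖ < r` satisfies `β = y·s²` for some `s ∈ K` (`ι` induces the topology (§1); `{β | v(β∕y − 1) < v(4)}` is an open neighbourhood of `y` on which `β∕y` is a
square, ★ `isSquare_of_valued_sub_one_lt_four_adicCompletion`). [cite: Serre1979, Ch. II §5; Ch. XIV §4] -/
theorem exists_radius_sq_class (hc : Continuous (algebraMap ℚ_[p] (w.adicCompletion L))) (ι : w.adicCompletion L →ₐ[ℚ_[p]] PadicAlgCl p)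
    {y : w.adicCompletion L} (hy0 : y ≠ 0) :
    ∃ r : ℝ, 0 < r ∧ ∀ β : w.adicCompletion L, ‖ι β - ι y‖ < r → ∃ s : w.adicCompletion L, β = y * s ^ 2 := by
  have hι := isInducing_algHom_padicAlgCl p hc ι
  -- the open neighbourhood `U` of `y`
  haveI : CharZero (w.adicCompletion L) := charZero_of_injective_algebraMap (algebraMap ℚ_[p] (w.adicCompletion L)).injective
  have h4 : (4 : w.adicCompletion L) ≠ 0 := by norm_num
  set U : Set (w.adicCompletion L) := (fun β => β / y - 1) ⁻¹' Metric.ball 0 ‖(4 : w.adicCompletion L)‖ with hU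
  have hUo : IsOpen U := Metric.isOpen_ball.preimage ((continuous_id.div_const y).sub continuous_const)
  have hyU : y ∈ U := by
    rw [hU, Set.mem_preimage, div_self hy0, sub_self, Metric.mem_ball, dist_zero_right, norm_zero, norm_pos_iff]
    exact h4
  -- pulled back through `ι`
  have hnhds : U ∈ Filter.comap ι (𝓝 (ι y)) := by
    rw [← hι.nhds_eq_comap]
    exact hUo.mem_nhds hyU
  obtain ⟨t, ht, htU⟩ := Filter.mem_comap.1 hnhds
  obtain ⟨r, hr, hball⟩ := Metric.mem_nhds_iff.1 ht
  refine ⟨r, hr, fun β hβ => ?_⟩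
  have hβU : β ∈ U := htU (hball (by rwa [Metric.mem_ball, dist_eq_norm]))
  rw [hU, Set.mem_preimage, Metric.mem_ball, dist_zero_right, Valued.toNormedField.norm_lt_iff] at hβU
  obtain ⟨s, hs⟩ := Literature.NumberTheory.LocalFields.isSquare_of_valued_sub_one_lt_four_adicCompletion L w (β / y) hβU
  exact ⟨s, by rw [sq, ← hs, mul_div_cancel₀ β hy0]⟩

/-- **HEAD (P2″) — KRASNER DATA TRANSPORT TO THE COMPLETION.**  `K := L_w` with a continuous finite `ℚ_p`-structure, `ι : K →ₐ[ℚ_p] Q̄_p`, `y ∈ K` non-zero with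
`ℚ_p⟮y⟯ = ⊤`.  There is `r > 0` such that for every `z ∈ Q̄_p` with `‖z − ι y‖ < r` and `ℚ_p⟮z⟯ = ℚ_p⟮ι y⟯` (★ `adjoin_eq_adjoin_of_coeff_near` delivers exactly this for a
root `z` of a nearby polynomial) there are `β, s ∈ K` with `ι β = z`, `ℚ_p⟮β⟯ = ⊤` and `β = y·s²`; by `denseRange_of_adjoin_eq_top` every field homomorphism into `K`
hitting `β` then has dense image (P1's input). [cite: Gouvea1993PadicNumbers, Cor. 6.8.3] [cite: NeukirchANT1999, Ch. II (8.2)-(8.4)] [cite: Serre1979, Ch. XIV §4] -/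
theorem exists_radius_transport_sq_class (hc : Continuous (algebraMap ℚ_[p] (w.adicCompletion L))) (ι : w.adicCompletion L →ₐ[ℚ_[p]] PadicAlgCl p)
    {y : w.adicCompletion L} (hy0 : y ≠ 0) (hy : ℚ_[p]⟮y⟯ = ⊤) :
    ∃ r : ℝ, 0 < r ∧ ∀ z : PadicAlgCl p, ‖z - ι y‖ < r → ℚ_[p]⟮z⟯ = ℚ_[p]⟮ι y⟯ →
      ∃ β s : w.adicCompletion L, ι β = z ∧ ℚ_[p]⟮β⟯ = ⊤ ∧ β = y * s ^ 2 := by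
  obtain ⟨r, hr, hsq⟩ := exists_radius_sq_class p w hc ι hy0
  refine ⟨r, hr, fun z hzr hz => ?_⟩
  obtain ⟨β, hβz, hβ⟩ := exists_eq_and_adjoin_eq_top p ι hy hz
  obtain ⟨s, hs⟩ := hsq β (by rwa [hβz])
  exact ⟨β, s, hβz, hβ, hs⟩

end AdicCompletion

end Summit.HodgeConjecture.HodgeConjecture.R90.S3

end
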